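/-
Copyright (c) 2026 the pub-hodgecm-mathlib formalisation cell (harness21).  Prover seat hodgecm-mathlib-R90-CS-p03 (g3), R90-TF section S8 «ContSpec-n½» (dealer R90-CS-plan (g3),
S8-R214 «`K2E1ChiArchA32ShiftedOfRecordU3` = the `hm1`-FREE A32 column»): ★ F5's `hA32` for the amplitude of record with p13's SHIFTED archimedean witness (★ p864325
`arch_integral_ne_zero_shifted`, every ODD coupling exponent) and the 𝔫-BALL finite half at the moved base point `ι_f(w₀^{S₀})` (★ p864319) — letters {`hε`, the `(m, p, q)` table clause, `hC`}.
-/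
import Summits.HodgeConjecture.HodgeConjecture.Theorems.K2E1ChiArchA32MovedBasePointU3      -- ★ p864319 (this seat): the 𝔫-ball (`isOpen_levelBall`, …, `localHeight_eq_one_of_mem_levelBall`); brings ★ p864169 `finiteHalf_ne_zero_of_testWeights`, ★ (a-4)
import Summits.HodgeConjecture.HodgeConjecture.Theorems.K2E1ChiArchShiftedNonvanishingU3      -- ★ p864325 (K2E1-p13 (g5)) (γ2): `arch_integral_ne_zero_shifted`
import Summits.HodgeConjecture.HodgeConjecture.Theorems.K2E1ChiArchShiftedExponentTableU3     -- ED. 2: ★ p864377 (K2E1-p13 (g5)): `shiftExponents_spec`, `odd_of_modEq_one_sub_two_mul` (the `(p,q)` table of record)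
import HarnessLib

/-!
# K2·E1 ∕ R90·S8 — `K2E1ChiArchA32ShiftedOfRecordU3`: ★ F5's `hA32` FOR A GENERAL BLOCK — THE SHIFTED ARCHIMEDEAN WITNESS × THE 𝔫-BALL FINITE HALF (the `hm1`-free column)

Cell `pub/hodgecm-mathlib`, crux h413 = `stmt-HodgeConjecture-24833`, route of record `HCCMUnconditional`; R90-TF section S8 «ContSpec-n½», road R2-χ₃ ((V) OF RECORD row (iii) `hA32`;
S8-R192 (∞-2) «general blocks: the shifted witness», F-A32 (R1) «moved base point»).  THEOREMS ONLY (no `def`, no `instance`, no notation, no named-fact hypothesis, no `sorry`;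
default heartbeats); lane `--supports stmt-HodgeConjecture-24833 --as helper` (count-neutral).  Closes no socket.

THE MATHEMATICS ([MoeglinWaldspurger1995] II.1.6–II.1.7, IV.1.11; [Rogawski1990] §13.9 p. 229; [Langlands1976] Appendix).  On a GENERAL block the coupling exponents `m_w = kμ,w − 2eη,w` are
ODD (p13's ★ table) but may have `|m_w| ≥ 3`, where ★ (a-10c)'s weight of record vanishes at `3∕2`; K2E1-p13's SHIFTED witness ★ `archSectionShifted … p q` repairs this: its big-cell weight
is `∏_w ε_w·archUnitaryValue m_w 0 ζ_w·((2+ζ_w)∕ζ_w)^{p_w}·((2+conj ζ_w)∕conj ζ_w)^{q_w}` with `m_w = 2p_w+1 ∧ q_w = 0` or `m_w = −(2q_w+1) ∧ p_w = 0`, and ★ p864325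
`arch_integral_ne_zero_shifted` proves `∫∫ (that weight)·ARCH₃^{−3∕2} ≠ 0` for EVERY odd `m_w` (constants `0 < ‖ε_w‖ ≤ 1`, `β_w² = (wδ)²`; here `β_w := Im φ_w(δ)`, ★ `embedding_im_sq`).
At the finite places the witness is read at the MOVED base point `ι_f(w₀^{S₀})` (F-A32 (R1)): its bad-place weights are the indicators of the 𝔫-balls `B_v(𝔫)` of ★ p864319 (open, `∋ 0`,
inside `𝒪_v³`, `Q_v = 1` on them), whose χ-local means are the `z`-free non-zero constants `ν(B_v(𝔫))∕ν(𝒪_v³)` (★ (a-4), ★ p864169 `finiteHalf_ne_zero_of_testWeights`).  Hence for the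
FULLY NAMED amplitude `A z := (C·∏_{v∈S₀} ν_v(𝒪_v³)⁻¹ • ∫ 𝟙_{B_v(𝔫)}·Q_v^{−z}) · ∫_{L_∞}∫_{L⁺_∞} (shifted weight)·ARCH₃^{−z}`: **`A (3 ∕ 2) ≠ 0`** in ★ F5's binder bytes.
* (ED. 2, S8-R216) **`hA32_shifted_of_record_at_basePoint_of_modEq`** — the same with the `(m, p, q)` table clause DISCHARGED BY NAME from the parity of record `kμ,w ≡ 1 [ZMOD 2]`
  (★ p864377 `shiftExponents_spec`: `m_w := kμ,w − 2·ξ.eη w`, `p_w := ((m_w−1)∕2).toNat`, `q_w := ((−m_w−1)∕2).toNat`); visible letters {`hε1 hε0`, `hk`, `hC`}.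
* HEAD **`hA32_shifted_of_record_at_basePoint`** — visible letters exactly {`hε1 hε0` (the unit constants `ε_w`, of record `χ₂,∞(det ι(w₀))`-type phases), the `(m, p, q)` TABLE CLAUSE `hm`
  (dischargeable from `kμ w ≡ 1 [ZMOD 2]` by p13's exponent-table file, S8-R214 (i)), `hC : C ≠ 0` (★ (a-2b): `C > 0`)}; NO hypothesis on `𝔫`.
HONEST SCOPE.  NOT here: the identification of this named `A` with the witness's intertwining scalar — the unfolding row `hsrc`∕`hUNF` (per-translate big-cell factorisation at
`g₁ = ι_f(w₀^{S₀})`: arch part ★ `archSectionShifted_midBlock_bigCell` + `archShiftFactor_bigCell_zeta` + the last-row readings `hℓ hy h0 h2`; finite part ★ (E-supp) + ★ (E-cell) at the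
level places with `𝔫 := 𝔫_cond·∏_{v∈S₀}∏_{w′∣v}𝔭_{w′}`, ★ C10-p07 FILES 1∕2∕3 at the inert ones) — the supplier estate.
HONEST LABEL: HC_CM is proved only modulo the 7 printed citations (2 remaining named inputs: hLiu418 = `stmt-HodgeConjecture-24832`, h413 = `stmt-HodgeConjecture-24833`) until rung 0
closes; REL ≠ ★ ≠ BUILT; this file asserts no named fact and closes no socket; count-neutral.

## References
* [MoeglinWaldspurger1995] C. Mœglin, J.-L. Waldspurger, *Spectral Decomposition and Eisenstein Series* (1995): II.1.6, II.1.7, IV.1.11.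
* [Rogawski1990] J. D. Rogawski, *Automorphic Representations of Unitary Groups in Three Variables*, Ann. of Math. Stud. 123 (1990): §13.9 p. 229.
* [Langlands1976] R. P. Langlands, *On the Functional Equations Satisfied by Eisenstein Series*, LNM 544 (1976): Appendix (rank one).
* [Patrikis2019] S. Patrikis, *Variations on a theorem of Tate*, Mem. AMS 258 (2019): §2.1.
-/

set_option autoImplicit false
set_option linter.dupNamespace false -- the mandated namespace repeats `HodgeConjecture.HodgeConjecture`

noncomputable section

open MeasureTheory MeasureTheory.Measure NumberField NumberField.InfinitePlace IsDedekindDomain Filter Set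
open scoped NNReal ENNReal ComplexConjugate
open Literature.NumberTheory.Automorphic Literature.NumberTheory.Automorphic.UnitaryGroup Literature.NumberTheory.GaloisRepresentations
open Literature.NumberTheory.GaloisRepresentations (archUnitaryValue)
open Literature.NumberTheory.GaloisRepresentations.IsNonarchimedeanLocalField
open Summit.HodgeConjecture.HodgeConjecture.Cruxes.H413
open Summit.HodgeConjecture.HodgeConjecture.Cruxes.H413.K2E1HeightBigCellLineFormulaU3 (embedding_im_sq)
open Summit.HodgeConjecture.HodgeConjecture.Cruxes.H413.K2E1ChiArchA32FiniteHalfOfRecordU3 (finiteHalf_ne_zero_of_testWeights)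
open Summit.HodgeConjecture.HodgeConjecture.Cruxes.H413.K2E1ChiArchA32MovedBasePointU3 (measurableSet_levelBall levelBall_measure_pos levelBall_measure_lt_top localHeight_eq_one_of_mem_levelBall)
open Summit.HodgeConjecture.HodgeConjecture.Cruxes.H413.K2E1ChiArchShiftedNonvanishingU3 (arch_integral_ne_zero_shifted)
open Summit.HodgeConjecture.HodgeConjecture.Cruxes.H413.K2E1ChiArchShiftedExponentTableU3 (shiftExponents_spec odd_of_modEq_one_sub_two_mul)

namespace Summit.HodgeConjecture.HodgeConjecture.Cruxes.H413.K2E1ChiArchA32ShiftedOfRecordU3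

variable (L : Type) [Field L] [NumberField L] [IsCMField L] {δ : L} (hcδ : IsCMField.complexConj L δ = -δ) (hδ : δ ≠ 0) (𝔫 : Ideal (𝓞 L))
  [∀ v : HeightOneSpectrum (𝓞 ↥(maximalRealSubfield L)), MeasurableSpace (v.adicCompletion ↥(maximalRealSubfield L))] [∀ v : HeightOneSpectrum (𝓞 ↥(maximalRealSubfield L)), BorelSpace (v.adicCompletion ↥(maximalRealSubfield L))]
  (νv : ∀ v : HeightOneSpectrum (𝓞 ↥(maximalRealSubfield L)), Measure (v.adicCompletion ↥(maximalRealSubfield L))) [∀ v, (νv v).IsAddHaarMeasure]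
  [MeasurableSpace (InfiniteAdeleRing L)] [BorelSpace (InfiniteAdeleRing L)]
  [MeasurableSpace (InfiniteAdeleRing ↥(maximalRealSubfield L))] [BorelSpace (InfiniteAdeleRing ↥(maximalRealSubfield L))]
  (μE₁ : Measure (InfiniteAdeleRing L)) [μE₁.IsAddHaarMeasure] (μF₁ : Measure (InfiniteAdeleRing ↥(maximalRealSubfield L))) [μF₁.IsAddHaarMeasure]

include hcδ hδ in
/-- **HEAD.  ★ F5's `hA32` FOR A GENERAL BLOCK: THE SHIFTED ARCHIMEDEAN WITNESS × THE 𝔫-BALL FINITE HALF AT THE MOVED BASE POINT.**  For unit constants `0 < ‖ε_w‖ ≤ 1`, an exponent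
table `(m, p, q)` with `m_w = 2p_w + 1 ∧ q_w = 0` or `m_w = −(2q_w + 1) ∧ p_w = 0` at every place (every ODD `m_w`), a bad finset `S₀`, an ideal `𝔫` and a constant `C ≠ 0`:
`A (3 ∕ 2) ≠ 0` for `A z := (C·∏_{v∈S₀} ν_v(𝒪_v³)⁻¹ • ∫ 𝟙_{B_v(𝔫)}·Q_v^{−z}) · ∫∫ (∏_w ε_w·archUnitaryValue m_w 0 ζ_w·((2+ζ_w)∕ζ_w)^{p_w}·((2+conj ζ_w)∕conj ζ_w)^{q_w})·ARCH₃^{−z}`,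
`ζ_w = −(1 + ‖Ξ_w‖²∕2) + i·Im φ_w(δ)·s_w(a)` — ★ p864169 finite half at the 𝔫-balls (★ p864319 §1) × ★ p864325 `arch_integral_ne_zero_shifted` (`β_w := Im φ_w(δ)`, ★ `embedding_im_sq`).
[cite: MoeglinWaldspurger1995, II.1.7, IV.1.11] [cite: Rogawski1990, §13.9 p. 229] [cite: Langlands1976, Appendix] -/
theorem hA32_shifted_of_record_at_basePoint (ε : InfinitePlace L → ℂ) (hε1 : ∀ w, ‖ε w‖ ≤ 1) (hε0 : ∀ w, ε w ≠ 0)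
    (m : InfinitePlace L → ℤ) (p q : InfinitePlace L → ℕ) (hm : ∀ w, (m w = 2 * (p w : ℤ) + 1 ∧ q w = 0) ∨ (m w = -(2 * (q w : ℤ) + 1) ∧ p w = 0))
    (S₀ : Finset (HeightOneSpectrum (𝓞 ↥(maximalRealSubfield L)))) {C : ℂ} (hC : C ≠ 0) :
    (fun z : ℂ => (C * ∏ v ∈ S₀, ((Measure.pi fun _ : Fin 3 => νv v) (integralBox ↥(maximalRealSubfield L) (Fin 3) v)).toReal⁻¹ •
        ∫ p : Fin 3 → v.adicCompletion ↥(maximalRealSubfield L),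
          Set.indicator {p : Fin 3 → v.adicCompletion ↥(maximalRealSubfield L) | p ∈ integralBox ↥(maximalRealSubfield L) (Fin 3) v ∧ ∀ w' : PlacesOver L v,
              Valued.v (quadraticLocalEquiv L v (IsCMField.complexConj L) hcδ hδ (p 0, p 1) w') ≤ idealRadius L w'.1 𝔫 ∧
              Valued.v (conjLocal L (IsCMField.complexConj L) v (quadraticLocalEquiv L v (IsCMField.complexConj L) hcδ hδ (p 0, p 1)) w') ≤ idealRadius L w'.1 𝔫 ∧
              Valued.v ((toLocalRing L v (p 2) * algebraMap L (LocalRing L v) δ -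
                toLocalRing L v 2⁻¹ * (quadraticLocalEquiv L v (IsCMField.complexConj L) hcδ hδ (p 0, p 1) * conjLocal L (IsCMField.complexConj L) v (quadraticLocalEquiv L v (IsCMField.complexConj L) hcδ hδ (p 0, p 1)))) w') ≤ idealRadius L w'.1 𝔫}
            (fun _ => (1 : ℂ)) p *
          (((∏ w' : PlacesOver L v, max 1 (max ((normAbs (w'.1.adicCompletion L) (quadraticLocalEquiv L v (IsCMField.complexConj L) hcδ hδ (p 0, p 1) w') : ℝ≥0) : ℝ)
            ((normAbs (w'.1.adicCompletion L) ((toLocalRing L v (p 2) * algebraMap L (LocalRing L v) δ -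
              toLocalRing L v 2⁻¹ * (quadraticLocalEquiv L v (IsCMField.complexConj L) hcδ hδ (p 0, p 1) *
                conjLocal L (IsCMField.complexConj L) v (quadraticLocalEquiv L v (IsCMField.complexConj L) hcδ hδ (p 0, p 1)))) w') : ℝ≥0) : ℝ))) : ℝ) : ℂ) ^ (-z) ∂(Measure.pi fun _ : Fin 3 => νv v)) *
      ∫ Xi : InfiniteAdeleRing L, ∫ a : InfiniteAdeleRing ↥(maximalRealSubfield L),
      (∏ w : InfinitePlace L, ε w * archUnitaryValue (m w) 0 ((((-(1 + ‖Xi w‖ ^ 2 / 2)) : ℝ) : ℂ) + (((w.embedding δ).im * ((InfiniteAdeleRing.ringEquiv_mixedSpace ↥(maximalRealSubfield L)) a).1 ⟨w.comap (algebraMap ↥(maximalRealSubfield L) L), K2E1HeightBigCellLineFormulaU2.isReal_comap_maximalRealSubfield L w⟩ : ℝ) : ℂ) * Complex.I) * (((2 : ℂ) + ((((-(1 + ‖Xi w‖ ^ 2 / 2)) : ℝ) : ℂ) + (((w.embedding δ).im * ((InfiniteAdeleRing.ringEquiv_mixedSpace ↥(maximalRealSubfield L)) a).1 ⟨w.comap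 (algebraMap ↥(maximalRealSubfield L) L), K2E1HeightBigCellLineFormulaU2.isReal_comap_maximalRealSubfield L w⟩ : ℝ) : ℂ) * Complex.I)) / ((((-(1 + ‖Xi w‖ ^ 2 / 2)) : ℝ) : ℂ) + (((w.embedding δ).im * ((InfiniteAdeleRing.ringEquiv_mixedSpace ↥(maximalRealSubfield L)) a).1 ⟨w.comap (algebraMap ↥(maximalRealSubfield L) L), K2E1HeightBigCellLineFormulaU2.isReal_comap_maximalRealSubfield L w⟩ : ℝ) : ℂ) * Complex.I)) ^ p w * (((2 : ℂ) + conj ((((-(1 + ‖Xi w‖ ^ 2 / 2)) : ℝ) : ℂ) + (((w.embedding δ).im * ((InfiniteAdeleRing.ringEquiv_mixedSpace ↥(maximalRealSubfield L)) a).1 ⟨w.comap (algebraMap ↥(maximalRealSubfield L) L), K2E1HeightBigCellLineFormulaU2.isReal_comap_maximalRealSubfield L w⟩ : ℝ) : ℂ) * Complex.I)) / conj ((((-(1 + ‖Xi w‖ ^ 2 / 2)) : ℝ) : ℂ) + (((w.embedding δ).im * ((InfiniteAdeleRing.ringEquiv_mixedSpace ↥(maximalRealSubfield L)) a).1 ⟨w.comap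 (algebraMap ↥(maximalRealSubfield L) L), K2E1HeightBigCellLineFormulaU2.isReal_comap_maximalRealSubfield L w⟩ : ℝ) : ℂ) * Complex.I)) ^ q w) *
        ((((∏ w : InfinitePlace L, ((1 + ‖(Xi) w‖ ^ 2 / 2) ^ 2 + (w δ) ^ 2 * (((InfiniteAdeleRing.ringEquiv_mixedSpace ↥(maximalRealSubfield L)) a).1 ⟨w.comap (algebraMap ↥(maximalRealSubfield L) L), K2E1HeightBigCellLineFormulaU2.isReal_comap_maximalRealSubfield L w⟩) ^ 2))) : ℝ) : ℂ) ^ (-z) ∂μF₁ ∂μE₁) (3 / 2) ≠ 0 :=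
  mul_ne_zero
    (finiteHalf_ne_zero_of_testWeights L hcδ hδ νv S₀
    (fun v => {p : Fin 3 → v.adicCompletion ↥(maximalRealSubfield L) | p ∈ integralBox ↥(maximalRealSubfield L) (Fin 3) v ∧ ∀ w' : PlacesOver L v,
              Valued.v (quadraticLocalEquiv L v (IsCMField.complexConj L) hcδ hδ (p 0, p 1) w') ≤ idealRadius L w'.1 𝔫 ∧
              Valued.v (conjLocal L (IsCMField.complexConj L) v (quadraticLocalEquiv L v (IsCMField.complexConj L) hcδ hδ (p 0, p 1)) w') ≤ idealRadius L w'.1 𝔫 ∧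
              Valued.v ((toLocalRing L v (p 2) * algebraMap L (LocalRing L v) δ -
                toLocalRing L v 2⁻¹ * (quadraticLocalEquiv L v (IsCMField.complexConj L) hcδ hδ (p 0, p 1) * conjLocal L (IsCMField.complexConj L) v (quadraticLocalEquiv L v (IsCMField.complexConj L) hcδ hδ (p 0, p 1)))) w') ≤ idealRadius L w'.1 𝔫})
    (fun v _ => measurableSet_levelBall L hcδ hδ v 𝔫) (fun v _ => levelBall_measure_pos L hcδ hδ v 𝔫 (νv v)) (fun v _ => levelBall_measure_lt_top L hcδ hδ v 𝔫 (νv v))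
    (fun v _ _ hp => localHeight_eq_one_of_mem_levelBall L hcδ hδ v 𝔫 hp) (fun _ => (1 : ℂ)) (fun _ _ => one_ne_zero) _
    (fun _ _ _ hp => Set.indicator_of_mem hp _) (fun _ _ _ hp => Set.indicator_of_notMem hp _) hC ((3 : ℂ) / 2))
    (arch_integral_ne_zero_shifted L hδ μE₁ μF₁ ε hε1 hε0 (fun w => (w.embedding δ).im) (fun w => embedding_im_sq L hcδ w) m p q hm)

include hcδ hδ in
/-- **HEAD (ED. 2, S8-R216).  ★ F5's `hA32` FOR THE BLOCK OF RECORD, TABLE CLAUSE DISCHARGED BY NAME**: for `ξ` and the unitary type `(kμ, 0)` of `μω` with `kμ,w ≡ 1 [ZMOD 2]` (the parity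
of record, ★ `exists_hasUnitaryArchType_of_hquad`), the coupling exponents `m_w := kμ,w − 2·ξ.eη w` are odd and the shifts of record `p_w := ((m_w − 1)∕2).toNat`,
`q_w := ((−m_w − 1)∕2).toNat` satisfy the table clause (★ p864377 `shiftExponents_spec`); so §1's head holds with those exponents: `A (3 ∕ 2) ≠ 0` for the named amplitude with the
𝔫-ball finite half and the shifted archimedean weight at `(m, p, q)` of record — visible letters exactly {`hε1 hε0`, `hk`, `hC`}. [cite: MoeglinWaldspurger1995, II.1.7, IV.1.11] [cite: Patrikis2019, §2.1] -/
theorem hA32_shifted_of_record_at_basePoint_of_modEq (ξ : Literature.NumberTheory.Rogawski1990.OneDimAutRepH L) (kμ : InfinitePlace L → ℤ) (hk : ∀ w, kμ w ≡ 1 [ZMOD 2])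
    (ε : InfinitePlace L → ℂ) (hε1 : ∀ w, ‖ε w‖ ≤ 1) (hε0 : ∀ w, ε w ≠ 0)
    (S₀ : Finset (HeightOneSpectrum (𝓞 ↥(maximalRealSubfield L)))) {C : ℂ} (hC : C ≠ 0) :
    (fun z : ℂ => (C * ∏ v ∈ S₀, ((Measure.pi fun _ : Fin 3 => νv v) (integralBox ↥(maximalRealSubfield L) (Fin 3) v)).toReal⁻¹ •
        ∫ p : Fin 3 → v.adicCompletion ↥(maximalRealSubfield L),
          Set.indicator {p : Fin 3 → v.adicCompletion ↥(maximalRealSubfield L) | p ∈ integralBox ↥(maximalRealSubfield L) (Fin 3) v ∧ ∀ w' : PlacesOver L v,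
              Valued.v (quadraticLocalEquiv L v (IsCMField.complexConj L) hcδ hδ (p 0, p 1) w') ≤ idealRadius L w'.1 𝔫 ∧
              Valued.v (conjLocal L (IsCMField.complexConj L) v (quadraticLocalEquiv L v (IsCMField.complexConj L) hcδ hδ (p 0, p 1)) w') ≤ idealRadius L w'.1 𝔫 ∧
              Valued.v ((toLocalRing L v (p 2) * algebraMap L (LocalRing L v) δ -
                toLocalRing L v 2⁻¹ * (quadraticLocalEquiv L v (IsCMField.complexConj L) hcδ hδ (p 0, p 1) * conjLocal L (IsCMField.complexConj L) v (quadraticLocalEquiv L v (IsCMField.complexConj L) hcδ hδ (p 0, p 1)))) w') ≤ idealRadius L w'.1 𝔫}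
            (fun _ => (1 : ℂ)) p *
          (((∏ w' : PlacesOver L v, max 1 (max ((normAbs (w'.1.adicCompletion L) (quadraticLocalEquiv L v (IsCMField.complexConj L) hcδ hδ (p 0, p 1) w') : ℝ≥0) : ℝ)
            ((normAbs (w'.1.adicCompletion L) ((toLocalRing L v (p 2) * algebraMap L (LocalRing L v) δ -
              toLocalRing L v 2⁻¹ * (quadraticLocalEquiv L v (IsCMField.complexConj L) hcδ hδ (p 0, p 1) *
                conjLocal L (IsCMField.complexConj L) v (quadraticLocalEquiv L v (IsCMField.complexConj L) hcδ hδ (p 0, p 1)))) w') : ℝ≥0) : ℝ))) : ℝ) : ℂ) ^ (-z) ∂(Measure.pi fun _ : Fin 3 => νv v)) *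
      ∫ Xi : InfiniteAdeleRing L, ∫ a : InfiniteAdeleRing ↥(maximalRealSubfield L),
      (∏ w : InfinitePlace L, ε w * archUnitaryValue (kμ w - 2 * ξ.eη w) 0 ((((-(1 + ‖Xi w‖ ^ 2 / 2)) : ℝ) : ℂ) + (((w.embedding δ).im * ((InfiniteAdeleRing.ringEquiv_mixedSpace ↥(maximalRealSubfield L)) a).1 ⟨w.comap (algebraMap ↥(maximalRealSubfield L) L), K2E1HeightBigCellLineFormulaU2.isReal_comap_maximalRealSubfield L w⟩ : ℝ) : ℂ) * Complex.I) * (((2 : ℂ) + ((((-(1 + ‖Xi w‖ ^ 2 / 2)) : ℝ) : ℂ) + (((w.embedding δ).im * ((InfiniteAdeleRing.ringEquiv_mixedSpace ↥(maximalRealSubfield L)) a).1 ⟨w.comap (algebraMap ↥(maximalRealSubfield L) L), K2E1HeightBigCellLineFormulaU2.isReal_comap_maximalRealSubfield L w⟩ : ℝ) : ℂ) * Complex.I)) / ((((-(1 + ‖Xi w‖ ^ 2 / 2)) : ℝ) : ℂ) + (((w.embedding δ).im * ((InfiniteAdeleRing.ringEquiv_mixedSpace ↥(maximalRealSubfield L))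 a).1 ⟨w.comap (algebraMap ↥(maximalRealSubfield L) L), K2E1HeightBigCellLineFormulaU2.isReal_comap_maximalRealSubfield L w⟩ : ℝ) : ℂ) * Complex.I)) ^ ((kμ w - 2 * ξ.eη w - 1) / 2).toNat * (((2 : ℂ) + conj ((((-(1 + ‖Xi w‖ ^ 2 / 2)) : ℝ) : ℂ) + (((w.embedding δ).im * ((InfiniteAdeleRing.ringEquiv_mixedSpace ↥(maximalRealSubfield L)) a).1 ⟨w.comap (algebraMap ↥(maximalRealSubfield L) L), K2E1HeightBigCellLineFormulaU2.isReal_comap_maximalRealSubfield L w⟩ : ℝ) : ℂ) * Complex.I)) / conj ((((-(1 + ‖Xi w‖ ^ 2 / 2)) : ℝ) : ℂ) + (((w.embedding δ).im * ((InfiniteAdeleRing.ringEquiv_mixedSpace ↥(maximalRealSubfield L)) a).1 ⟨w.comap (algebraMap ↥(maximalRealSubfield L) L), K2E1HeightBigCellLineFormulaU2.isReal_comap_maximalRealSubfield L w⟩ : ℝ) : ℂ) * Complex.I)) ^ ((-(kμ w - 2 * ξ.eη w) - 1) / 2).toNat) *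
        ((((∏ w : InfinitePlace L, ((1 + ‖(Xi) w‖ ^ 2 / 2) ^ 2 + (w δ) ^ 2 * (((InfiniteAdeleRing.ringEquiv_mixedSpace ↥(maximalRealSubfield L)) a).1 ⟨w.comap (algebraMap ↥(maximalRealSubfield L) L), K2E1HeightBigCellLineFormulaU2.isReal_comap_maximalRealSubfield L w⟩) ^ 2))) : ℝ) : ℂ) ^ (-z) ∂μF₁ ∂μE₁) (3 / 2) ≠ 0 :=
  hA32_shifted_of_record_at_basePoint L hcδ hδ 𝔫 νv μE₁ μF₁ ε hε1 hε0 (fun w => kμ w - 2 * ξ.eη w) (fun w => ((kμ w - 2 * ξ.eη w - 1) / 2).toNat)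
    (fun w => ((-(kμ w - 2 * ξ.eη w) - 1) / 2).toNat) (shiftExponents_spec (fun w => kμ w - 2 * ξ.eη w) fun w => odd_of_modEq_one_sub_two_mul (hk w) (ξ.eη w)) S₀ hC

end Summit.HodgeConjecture.HodgeConjecture.Cruxes.H413.K2E1ChiArchA32ShiftedOfRecordU3

end
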